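import Literature.MathematicalPhysics.QuantumFieldTheory.Balaban1983to89.B6GOneLevelV1Bridge
import Literature.MathematicalPhysics.QuantumFieldTheory.Balaban1983to89.B5G115SupBound
import Summits.QuantumFields.YangMills.Theorems.UnitScaleTiltProp7FlatCoercivityR
import HarnessLib

/-!
# Route `UnitScaleTilt`, crux K1 child «MinimiserStabilityRegPr» (stmt-QuantumFields-19200), leaves V2′ (one-step halving, Sect. F) and V3 (Prop. 7):
# **[Balaban1984PropagatorsI] (1.115)/(1.110), FIRST ENTRY, FOR THE FLAT CONSTRAINED VECTOR PROPAGATOR `G = Δ_1⁻¹` OF [Balaban1984PropagatorsII]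
# (2.19)/(2.90) ON THE SETUP TORUS — `‖GJ‖_∞ ≤ C(d)‖J‖_∞` and `|(GJ)(b)| ≤ C(d)·e^{−δ(d)|y − y′|}‖J‖_∞` for `supp J ⊂ B^j(y′)`, `b₋ ∈ B^j(y)`,
# UNIFORM IN THE LEVEL `j`, IN `L` AND IN THE VOLUME — by BRIDGE from pub-balaban's kernel certificates; instances at the d = 3 carrier**

Cell `ym3-torus` (HUMAN RULING D-0037, YM ladder rung R3), seat `ym3-torus-p1` gen 14 (UV side); memo HOME/UV3-NODE.md §23.  `--supports
stmt-QuantumFields-19200 --as helper`.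

WHY.  The fleet's census of V2 `stub_prop8` (CENSUS-19200-V2, evidence #43–#45 on 19200) and the owner's work map for the v7 stub V2′
`stub_halvingStep` (OWNER RULING g20-№2 (B3)) both name, as the located-XL input shared by V2′ and V3, the SUP-NORM and LONG-DISTANCE DECAY
bounds for the FLAT constrained propagators of [Balaban1984PropagatorsI]/[Balaban1984PropagatorsII] at the carrier («(D3) … MISSING: …
‖G‖_{∞→∞} … and the long-distance decay at the carrier»; [Balaban1985Variational] Sect. F (162)–(164) p. 302: *«all the operators in this
section are taken without any external gauge field configuration … These operators were considered in [2,3]»*, with [Balaban1984PropagatorsII]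
Prop. 2.2 p. 234: *«the operator G′ = Δ′_a^{−1} (a = 1) satisfies the inequalities |(G′λ)(x)|, … ≤ O(1)[(L^jη)², …]·e^{−½δ₀d(y,y′)}|λ|»*).
THE FIRST ENTRY OF BOTH IS ALREADY KERNEL-CERTIFIED — in pub-balaban b05's torus-multiplier carrier: `B5G115SupBound.norm_DeltaA_one_inv_mulVec_le_global`
((1.115) first entry, `a = 1`, `U = 1`, constants functions of `d` only, uniform in the block size `n = L^j` and in the torus) and
`B5G183FreeRowSum.norm_DeltaA_one_inv_mulVec_le_uniform` ((1.110) first entry, localized, decay `e^{−δ|y−y′|_{T,∞}}`).  lit-balaban r03's ONE-LEVEL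
OPERATOR BRIDGE `B6GOneLevelV1Bridge.TV_GE_twoScale_empty` («(2.19) = (1.69)»: `(G^{V1}x)~ = (Δ_a^{[B5]})⁻¹·x̃` for the one-level two-scale structure
`twoScale j hj1 ∅` of (2.90), lattice factor `L^j`, weight `a·(L^j)^d`) identifies b05's matrix with the V1 operator `G = B6SectAVectorModelV1.GE` of
(2.22) on the Setup torus `Site P 0`, and p16's block dictionary `B5Eq117TorusCarriers.EK_blockSiteK`/`blockEquivK` identifies Bałaban's blocks
`B^j(y)` (`B5Eq118OneStroke.iterBlock`) with b05's `bpt`.  THIS FILE COMPOSES THEM (no analysis re-proved; the same move as the item's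
`Prop7FlatCoercivityR` for (1.90) and the T⁴ lineage's `SliceFlatPropagator` for their carrier):
* §1 `GE_eq_re` — the value dictionary `(Gx)(b) = Re ((Δ_1^{[B5]})⁻¹x̃)(EK b₋, μ(b))`; `exists_EK_eq_bpt` — sites of `B^j(y)` are block points.
* §2 **`abs_GE_le_sup`** — (1.115) first entry for EVERY `P : Params` (any `d ≥ 1`, odd `L > 1`, volume `m`, run `K`), every level `j` with
  `j + 1 ≤ m + K`, weight `(L^j)^d` (= [B5] `a = 1`): `|(Gx)(b)| ≤ B·C_sup(d)` whenever `|x| ≤ B` — `C_sup(d)` b05's constant (at their splitting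
  order `N = d − 1`), a function of `d` ALONE.  (b05 states its theorems for dimension `d + 1`; the general `P` is reached by `cases P`.)
* §3 **`abs_GE_le_decay`** — (1.110) first entry at the parameter set `(d+1, L, m, K)`: for `x` supported on the bonds issuing from `B^j(y′)` and
  `b₋ ∈ B^j(y)`, `|(Gx)(b)| ≤ B·(C₁(d)e^{−δ₁(d)t} + C₂(d)e^{−δ₂(d)t})`, `t = |ỹ − ỹ′|_{T,∞}` the sup torus distance of the integer representatives
  (`B4TorusKernel.MultiPeriod.torusSupNorm`, `B6LowerBound2153Torus.rep`), every constant a function of `d` alone.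
* §4 **AT THE d = 3 CARRIER** of `T3Thm1Carrier.varProblem3 F n K` (fine torus `Site (F.P K) 0`, `j = K − n`, one more level by `m ≥ 1` —
  `Prop7FlatCoercivityR.succ_le_T3`): `abs_GE_le_sup_T3` with the ABSOLUTE constant `16e^{1/6}K₃(1/6) + 3·M_D(3,2)·C_per(κ₁₈₃(3),2)·K₃(κ₁₈₃(3)/3)`,
  `abs_GE_le_decay_T3`, the single-rate form **`abs_GE_le_exp_T3`** (`|(Gx)(b)| ≤ C₀·B·e^{−δ₀t}`, `δ₀ = min{1/6, κ₁₈₃(3)/3}`), and the packaged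
  **`exists_flatG_sup_decay_T3 : ∃ C δ > 0, ∀ F n K …`** — uniform in the family member (`L`, `m`), in `n` and in `K`.
HONEST SCOPE.  (i) FIRST ENTRY ONLY: not `|∇GJ|`, `|G∇*J|`, `|ΔGJ|`, not the Hölder entries (b05 HONEST SCOPE (i)) — [Balaban1985Variational] (162)–(164)
use those too; (ii) `a = 1` (print's, Prop. 2.2), `U = 1` (flat), ONE level (all `Ω_i = T_η`, `Λ′ = ∅` — the pure small-field problem of the carrier);
(iii) the constrained operator is (2.19)'s `Δ_a = ∂*∂ + ∂R∂* + Q*aQ` with print's residual-gauge `R` (NOT the sharp-constraint `H`/`G₁` of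
[Balaban1985Variational] (45)–(46) / [Balaban1985BackgroundPropagators] §3); (iv) constants crude (b05's), nothing printed is matched; (v) the unit cubes are
Bałaban's blocks `B^j(y)` (b05's `Δ = B` reading of `Δ̃`).  No definition, no sorry, standard axioms.  NOT a claim about the mass gap.

References: T. Bałaban, CMP **95** (1984) 17–40 [Balaban1984PropagatorsI] Prop. 1.2 (1.110) p.35, (1.115) p.36, (1.69)–(1.71) pp.29–30; CMP **96** (1984)
223–250 [Balaban1984PropagatorsII] (2.19)/(2.22) p.226, Prop. 2.2 (2.67) p.234, (2.90) p.239; CMP **102** (1985) 277–309 [Balaban1985Variational] Sect. F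
(162)–(164) p.302.
-/

set_option autoImplicit false

noncomputable section

open scoped BigOperators InnerProductSpace Matrix ComplexConjugate

namespace Summit.QuantumFields.YangMills.Theorems.FlatPropagatorSup

open Literature.MathematicalPhysics.QuantumFieldTheory.Balaban1983to89
open Literature.MathematicalPhysics.QuantumFieldTheory.BalabanImbrieJaffe1984to88.BIJ85AxialPropagator411 (BondSpace)
open LatticeFieldCalculus B6SectADomainsV1 B6SectAOperatorsV1 B6SectAVectorModelV1 B6SectCTwoScaleV1 B6GOneLevelV1Bridge
open B5Eq117TorusCarriers (Mk EK EK_blockSiteK blockSiteK blockEquivK)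
open B5Eq118OneStroke (iterBlock iterBlockOf mem_iterBlock)
open B5Prop11Plancherel (Tor fine)
open B5DeltaA169 (DeltaA)
open B5Block118 (bpt)
open B4TorusKernel (periodConst)
open B4TorusKernel.MultiPeriod (torusSupNorm torusSupNorm_nonneg)
open B5G183Strip (kappa183 kappa183_pos)
open B5G183CovDecay (MD183 MD183_nonneg)
open B5Kernel166Decay (periodConst_pos)
open B6LowerBound2153Torus (toT rep toT_rep)
open B4Sect5Proof (latticeConst latticeConst_nonneg)
open B5G115SupBound (norm_DeltaA_one_inv_mulVec_le_global)
open B5G183FreeRowSum (norm_DeltaA_one_inv_mulVec_le_uniform)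

variable {P : Params} {j : ℕ}

/-! ## §1 The value dictionary and the block dictionary -/

/-- **`(Gx)(b) = Re ((Δ_1^{[B5]})⁻¹ x̃)(EK b₋, μ(b))`** — the V1 propagator `G = Δ_a⁻¹` of (2.22) for the one-level structure `twoScale j hj1 ∅`
(lattice factor `L^j`, weight `(L^j)^d` = [B5] `a = 1`) evaluated at a bond is the real part of b05's torus matrix inverse applied to the transported
field (r03's `TV_GE_twoScale_empty` read at one entry). [cite: Balaban1984PropagatorsII, (2.22) p.226, (2.90) p.239; Balaban1984PropagatorsI, (1.71) p.30] -/
theorem GE_eq_re (hj1 : j + 1 ≤ P.m + P.K)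
    {w : BondIdx (twoScale j hj1 (∅ : Finset (Site P (j + 1)))) → ℝ}
    (hw : ∀ i, 0 < w i) (hwa : ∀ p, w p = ((P.L : ℝ) ^ j) ^ P.d) (x : BondSpace P) (b : PBond P 0) :
    GE (twoScale j hj1 ∅) (c := (P.L : ℝ) ^ j) (pow_ne_zero j (Nat.cast_ne_zero.2 P.L_pos.ne')) hw x b
      = (((DeltaA (P.L ^ j) (Mk P j) 1)⁻¹ *ᵥ TV (Nat.le_of_succ_le hj1) x) (EK (Nat.le_of_succ_le hj1) b.src, b.dir)).re := by
  have hwa' : ∀ p, w p = 1 * ((P.L : ℝ) ^ j) ^ P.d := fun p => by rw [hwa, one_mul]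
  have h := congrArg (fun F => (F (EK (Nat.le_of_succ_le hj1) b.src, b.dir)).re) (TV_GE_twoScale_empty hj1 hw one_pos hwa' x)
  rw [TV_apply_EK, Complex.ofReal_re] at h
  exact h

/-- **Every site of Bałaban's block `B^j(y)` is a block point**: `x ∈ B^j(y)` ⇒ `EK x = bpt_{L^j} y r` for some offset `r` (p16's `blockEquivK` and
`EK_blockSiteK`). [cite: Balaban1984PropagatorsI, (1.6) p.18, (1.18) p.20] -/
theorem exists_EK_eq_bpt (hj : j ≤ P.m + P.K) {y : Site P j} {x : Site P 0} (hx : x ∈ iterBlock j y) :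
    ∃ r : Fin P.d → Fin (P.L ^ j), EK hj x = bpt (P.L ^ j) (Mk P j) y r := by
  refine ⟨(blockEquivK hj y).symm ⟨x, hx⟩, ?_⟩
  have h : blockSiteK j y ((blockEquivK hj y).symm ⟨x, hx⟩) = x :=
    congrArg Subtype.val ((blockEquivK hj y).apply_symm_apply ⟨x, hx⟩)
  rw [← EK_blockSiteK hj, h]

/-! ## §2 (1.115), first entry: the sup bound, every `Params`, uniformly in the level and the volume -/

/-- **[Balaban1984PropagatorsI] (1.115), FIRST ENTRY, FOR THE V1 PROPAGATOR ON THE SETUP TORUS — EVERY `P : Params`**: for the one-level structure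
`twoScale j hj1 ∅` (`j + 1 ≤ m + K`), lattice factor `L^j`, weight `(L^j)^d` ([B5] `a = 1`), every real bond field `x` with `|x(b′)| ≤ B` for all `b′`
and every bond `b`: `|(Gx)(b)| ≤ B·C_sup(d)`,
`C_sup(d) = 2(d−1)2^{d−1}e^{1/(2d)}K_d(1/(2d)) + d·M_D(d, d−1)·C_per(κ₁₈₃(d), d−1)·K_d(κ₁₈₃(d)/d)` (`K_d = B4Sect5Proof.latticeConst`, `M_D = B5G183CovDecay.MD183`,
`C_per = B4TorusKernel.periodConst`, `κ₁₈₃ = B5G183Strip.kappa183`) — a function of `d` ALONE: uniform in `j`, `L`, `m`, `K`.  b05's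
`norm_DeltaA_one_inv_mulVec_le_global` through §1. [cite: Balaban1984PropagatorsI, (1.115) p.36; Balaban1984PropagatorsII, Prop. 2.2 (2.67) p.234] -/
theorem abs_GE_le_sup (hj1 : j + 1 ≤ P.m + P.K)
    {w : BondIdx (twoScale j hj1 (∅ : Finset (Site P (j + 1)))) → ℝ}
    (hw : ∀ i, 0 < w i) (hwa : ∀ p, w p = ((P.L : ℝ) ^ j) ^ P.d) (x : BondSpace P) {B : ℝ} (hxB : ∀ b', |x b'| ≤ B)
    (b : PBond P 0) :
    |GE (twoScale j hj1 ∅) (c := (P.L : ℝ) ^ j) (pow_ne_zero j (Nat.cast_ne_zero.2 P.L_pos.ne')) hw x b|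
      ≤ B * (2 * (P.d - 1 : ℕ) * 2 ^ (P.d - 1) * Real.exp (1 / (2 * P.d)) * latticeConst P.d (1 / (2 * P.d))
          + P.d * (MD183 P.d (P.d - 1) * periodConst (kappa183 P.d) (P.d - 1)
              * latticeConst P.d (kappa183 P.d / P.d))) := by
  rw [GE_eq_re hj1 hw hwa x b]
  obtain ⟨dP, L, m, K, hd, hL⟩ := P
  obtain ⟨d, rfl⟩ : ∃ d, dP = d + 1 := ⟨dP - 1, by omega⟩
  refine (Complex.abs_re_le_norm _).trans ?_
  have hn : 1 ≤ L ^ j := Nat.one_le_pow _ _ (by have := hL.2; omega)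
  haveI : NeZero (L ^ j) := ⟨by have := hL.2; positivity⟩
  have hJB : ∀ i, ‖TV (P := (⟨d + 1, L, m, K, hd, hL⟩ : Params)) (Nat.le_of_succ_le hj1) x i‖ ≤ B := by
    rintro ⟨z, μ⟩
    rw [TV_apply, Complex.norm_real, Real.norm_eq_abs]
    exact hxB _
  have h := norm_DeltaA_one_inv_mulVec_le_global (L ^ j) hn (Mk (⟨d + 1, L, m, K, hd, hL⟩ : Params) j) (Nn := d) le_rfl
    (TV (P := (⟨d + 1, L, m, K, hd, hL⟩ : Params)) (Nat.le_of_succ_le hj1) x) hJB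
    (EK (P := (⟨d + 1, L, m, K, hd, hL⟩ : Params)) (Nat.le_of_succ_le hj1) b.src, b.dir)
  simpa using h

/-! ## §3 (1.110), first entry: the localized bound with exponential decay on the unit scale -/

section Decay

variable {d L m K : ℕ} {hd : 1 ≤ d + 1} {hL : Odd L ∧ 1 < L}

/-- **[Balaban1984PropagatorsI] PROP. 1.2 (1.110), FIRST ENTRY, FOR THE V1 PROPAGATOR ON THE SETUP TORUS** (parameter set `(d+1, L, m, K)`, every
`d`, odd `L > 1`, `m`, `K`; one level `j`, `j + 1 ≤ m + K`; weight `(L^j)^{d+1}` = [B5] `a = 1`): if the real bond field `x` satisfies `|x| ≤ B` and is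
SUPPORTED ON THE BONDS ISSUING FROM THE BLOCK `B^j(y′)`, then at every bond `b` issuing from `B^j(y)`
`|(Gx)(b)| ≤ B·(2d·2^d·e^{δ₁}·e^{−δ₁t} + (d+1)·M_D(d+1,d)·C_per(κ₁₈₃(d+1),d)·e^{−δ₂t})`, `δ₁ = 1/(2(d+1))`, `δ₂ = κ₁₈₃(d+1)/(d+1)`,
`t = |ỹ − ỹ′|_{T,∞}` (`torusSupNorm` of the difference of the integer representatives `rep`) — every constant a function of `d` alone.  b05's
`norm_DeltaA_one_inv_mulVec_le_uniform` through §1 (support transported by `exists_EK_eq_bpt`).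
[cite: Balaban1984PropagatorsI, Prop. 1.2 (1.110) p.35; Balaban1984PropagatorsII, Prop. 2.2 (2.67) p.234] -/
theorem abs_GE_le_decay (hj1 : j + 1 ≤ m + K)
    {w : BondIdx (twoScale (P := (⟨d + 1, L, m, K, hd, hL⟩ : Params)) j hj1
      (∅ : Finset (Site (⟨d + 1, L, m, K, hd, hL⟩ : Params) (j + 1)))) → ℝ}
    (hw : ∀ i, 0 < w i) (hwa : ∀ p, w p = ((L : ℝ) ^ j) ^ (d + 1))
    (x : BondSpace (⟨d + 1, L, m, K, hd, hL⟩ : Params)) {B : ℝ} (hxB : ∀ b', |x b'| ≤ B)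
    (y y' : Site (⟨d + 1, L, m, K, hd, hL⟩ : Params) j)
    (hsupp : ∀ b', x b' ≠ 0 → b'.src ∈ iterBlock j y')
    (b : PBond (⟨d + 1, L, m, K, hd, hL⟩ : Params) 0) (hb : b.src ∈ iterBlock j y) :
    |GE (twoScale j hj1 ∅) (c := (((⟨d + 1, L, m, K, hd, hL⟩ : Params).L : ℝ)) ^ j)
        (pow_ne_zero j (Nat.cast_ne_zero.2 (⟨d + 1, L, m, K, hd, hL⟩ : Params).L_pos.ne')) hw x b|
      ≤ B * (2 * d * 2 ^ d * Real.exp (1 / (2 * (d + 1)))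
              * Real.exp (-(1 / (2 * (d + 1)) *
                  torusSupNorm (Mk (⟨d + 1, L, m, K, hd, hL⟩ : Params) j)
                    (rep (Mk (⟨d + 1, L, m, K, hd, hL⟩ : Params) j) y - rep (Mk (⟨d + 1, L, m, K, hd, hL⟩ : Params) j) y')))
          + (d + 1) * (MD183 (d + 1) d * periodConst (kappa183 (d + 1)) d
              * Real.exp (-(kappa183 (d + 1) / (d + 1) *
                  torusSupNorm (Mk (⟨d + 1, L, m, K, hd, hL⟩ : Params) j)
                    (rep (Mk (⟨d + 1, L, m, K, hd, hL⟩ : Params) j) y - rep (Mk (⟨d + 1, L, m, K, hd, hL⟩ : Params) j) y'))))) := by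
  have hj : j ≤ m + K := Nat.le_of_succ_le hj1
  rw [GE_eq_re hj1 hw hwa x b]
  refine (Complex.abs_re_le_norm _).trans ?_
  have hn : 1 ≤ L ^ j := Nat.one_le_pow _ _ (by have := hL.2; omega)
  haveI : NeZero (L ^ j) := ⟨by have := hL.2; positivity⟩
  have hJB : ∀ i, ‖TV (P := (⟨d + 1, L, m, K, hd, hL⟩ : Params)) hj x i‖ ≤ B := by
    rintro ⟨z, μ⟩
    rw [TV_apply, Complex.norm_real, Real.norm_eq_abs]
    exact hxB _
  have hJsupp : ∀ i, TV (P := (⟨d + 1, L, m, K, hd, hL⟩ : Params)) hj x i ≠ 0 →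
      ∃ r' : Fin (d + 1) → Fin (L ^ j), i.1 = bpt (L ^ j) (Mk (⟨d + 1, L, m, K, hd, hL⟩ : Params) j)
        (toT (Mk (⟨d + 1, L, m, K, hd, hL⟩ : Params) j) (rep (Mk (⟨d + 1, L, m, K, hd, hL⟩ : Params) j) y')) r' := by
    rintro ⟨z, μ⟩ hz
    rw [TV_apply, Ne, Complex.ofReal_eq_zero] at hz
    have hmem := hsupp ⟨(EK (P := (⟨d + 1, L, m, K, hd, hL⟩ : Params)) hj).symm z, μ⟩ hz
    obtain ⟨r', hr'⟩ := exists_EK_eq_bpt (P := (⟨d + 1, L, m, K, hd, hL⟩ : Params)) hj hmem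
    rw [Equiv.apply_symm_apply] at hr'
    exact ⟨r', by rw [toT_rep]; exact hr'⟩
  obtain ⟨r, hr⟩ := exists_EK_eq_bpt (P := (⟨d + 1, L, m, K, hd, hL⟩ : Params)) hj hb
  have h := norm_DeltaA_one_inv_mulVec_le_uniform (L ^ j) hn (Mk (⟨d + 1, L, m, K, hd, hL⟩ : Params) j) (Nn := d) le_rfl
    (rep (Mk (⟨d + 1, L, m, K, hd, hL⟩ : Params) j) y) (rep (Mk (⟨d + 1, L, m, K, hd, hL⟩ : Params) j) y')
    (TV (P := (⟨d + 1, L, m, K, hd, hL⟩ : Params)) hj x) hJB hJsupp r b.dir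
  rw [toT_rep, ← hr] at h
  exact h

end Decay

/-! ## §4 At the d = 3 carrier (fine torus `Site (F.P K) 0`, level `j = K − n`) -/

section T3

open T3ContinuumYM3Torus (T3Family)
open Prop7FlatCoercivityR (succ_le_T3)

/-- **(1.115), FIRST ENTRY, AT THE d = 3 CARRIER, ABSOLUTE CONSTANT**: for every member `F` of the T³ family, heights `n, K`, the one-level structure at
`j = K − n` on the fine torus of run `K` (weight `(L^{K−n})³`, [B5] `a = 1`), every real bond field with `|x| ≤ B` and every bond `b`:
`|(Gx)(b)| ≤ B·C_sup(3)`, `C_sup(3) = 16e^{1/6}K₃(1/6) + 3·M_D(3,2)·C_per(κ₁₈₃(3),2)·K₃(κ₁₈₃(3)/3)` — INDEPENDENT of `F` (block size `L`, volume `m`), `n`, `K`.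
[cite: Balaban1984PropagatorsI, (1.115) p.36; Balaban1985Variational, Sect. F (162)–(164) p.302] -/
theorem abs_GE_le_sup_T3 (F : T3Family) (n K : ℕ)
    {w : BondIdx (twoScale (K - n) (succ_le_T3 F n K) (∅ : Finset (Site (F.P K) (K - n + 1)))) → ℝ}
    (hw : ∀ i, 0 < w i) (hwa : ∀ p, w p = ((F.L : ℝ) ^ (K - n)) ^ 3)
    (x : BondSpace (F.P K)) {B : ℝ} (hxB : ∀ b', |x b'| ≤ B) (b : PBond (F.P K) 0) :
    |GE (twoScale (K - n) (succ_le_T3 F n K) ∅) (c := ((F.L : ℝ)) ^ (K - n))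
        (pow_ne_zero (K - n) (Nat.cast_ne_zero.2 (F.P K).L_pos.ne')) hw x b|
      ≤ B * (16 * Real.exp (1 / 6) * latticeConst 3 (1 / 6)
          + 3 * (MD183 3 2 * periodConst (kappa183 3) 2 * latticeConst 3 (kappa183 3 / 3))) := by
  have h : |GE (twoScale (K - n) (succ_le_T3 F n K) ∅) (c := ((F.L : ℝ)) ^ (K - n))
        (pow_ne_zero (K - n) (Nat.cast_ne_zero.2 (F.P K).L_pos.ne')) hw x b|
      ≤ B * (2 * ((3 - 1 : ℕ) : ℝ) * 2 ^ (3 - 1) * Real.exp (1 / (2 * ((3 : ℕ) : ℝ))) * latticeConst 3 (1 / (2 * ((3 : ℕ) : ℝ)))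
          + ((3 : ℕ) : ℝ) * (MD183 3 (3 - 1) * periodConst (kappa183 3) (3 - 1) * latticeConst 3 (kappa183 3 / ((3 : ℕ) : ℝ)))) :=
    abs_GE_le_sup (P := F.P K) (succ_le_T3 F n K) hw hwa x hxB b
  refine h.trans (le_of_eq ?_)
  congr 1
  norm_num

/-- **(1.110), FIRST ENTRY, AT THE d = 3 CARRIER** (two rates): `x` supported on the bonds issuing from `B^{K−n}(y′)`, `|x| ≤ B`, `b₋ ∈ B^{K−n}(y)` ⇒
`|(Gx)(b)| ≤ B·(16e^{1/6}e^{−t/6} + 3·M_D(3,2)·C_per(κ₁₈₃(3),2)·e^{−(κ₁₈₃(3)/3)t})`, `t = |ỹ − ỹ′|_{T,∞}` on the unit torus `T^{(K−n)}` — uniform in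
`F`, `n`, `K`. [cite: Balaban1984PropagatorsI, Prop. 1.2 (1.110) p.35; Balaban1985Variational, Sect. F (162)–(164) p.302] -/
theorem abs_GE_le_decay_T3 (F : T3Family) (n K : ℕ)
    {w : BondIdx (twoScale (K - n) (succ_le_T3 F n K) (∅ : Finset (Site (F.P K) (K - n + 1)))) → ℝ}
    (hw : ∀ i, 0 < w i) (hwa : ∀ p, w p = ((F.L : ℝ) ^ (K - n)) ^ 3)
    (x : BondSpace (F.P K)) {B : ℝ} (hxB : ∀ b', |x b'| ≤ B)
    (y y' : Site (F.P K) (K - n)) (hsupp : ∀ b', x b' ≠ 0 → b'.src ∈ iterBlock (K - n) y')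
    (b : PBond (F.P K) 0) (hb : b.src ∈ iterBlock (K - n) y) :
    |GE (twoScale (K - n) (succ_le_T3 F n K) ∅) (c := ((F.L : ℝ)) ^ (K - n))
        (pow_ne_zero (K - n) (Nat.cast_ne_zero.2 (F.P K).L_pos.ne')) hw x b|
      ≤ B * (16 * Real.exp (1 / 6)
              * Real.exp (-(1 / 6 * torusSupNorm (Mk (F.P K) (K - n)) (rep (Mk (F.P K) (K - n)) y - rep (Mk (F.P K) (K - n)) y')))
          + 3 * (MD183 3 2 * periodConst (kappa183 3) 2
              * Real.exp (-(kappa183 3 / 3 *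
                  torusSupNorm (Mk (F.P K) (K - n)) (rep (Mk (F.P K) (K - n)) y - rep (Mk (F.P K) (K - n)) y'))))) := by
  have h : |GE (twoScale (K - n) (succ_le_T3 F n K) ∅) (c := ((F.L : ℝ)) ^ (K - n))
        (pow_ne_zero (K - n) (Nat.cast_ne_zero.2 (F.P K).L_pos.ne')) hw x b|
      ≤ B * (2 * ((2 : ℕ) : ℝ) * 2 ^ (2 : ℕ) * Real.exp (1 / (2 * (((2 : ℕ) : ℝ) + 1)))
              * Real.exp (-(1 / (2 * (((2 : ℕ) : ℝ) + 1)) *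
                  torusSupNorm (Mk (F.P K) (K - n)) (rep (Mk (F.P K) (K - n)) y - rep (Mk (F.P K) (K - n)) y')))
          + (((2 : ℕ) : ℝ) + 1) * (MD183 (2 + 1) 2 * periodConst (kappa183 (2 + 1)) 2
              * Real.exp (-(kappa183 (2 + 1) / (((2 : ℕ) : ℝ) + 1) *
                  torusSupNorm (Mk (F.P K) (K - n)) (rep (Mk (F.P K) (K - n)) y - rep (Mk (F.P K) (K - n)) y'))))) :=
    abs_GE_le_decay (d := 2) (L := F.L) (m := F.m) (K := K) (hd := by norm_num) (hL := F.hL)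
      (succ_le_T3 F n K) hw hwa x hxB y y' hsupp b hb
  refine h.trans (le_of_eq ?_)
  congr 1
  norm_num

/-- The sup torus distance on the unit torus `T^{(K−n)}` of the d = 3 carrier is non-negative (bookkeeping; every period is `≥ 1`).
[cite: Balaban1984PropagatorsI, (1.108) p.35] -/
theorem torusSupNorm_T3_nonneg (F : T3Family) (K j : ℕ) (z : Fin 3 → ℤ) : 0 ≤ torusSupNorm (Mk (F.P K) j) z :=
  torusSupNorm_nonneg (fun _ => Nat.one_le_iff_ne_zero.2 ((F.P K).sitesPerDir_ne_zero j)) z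

/-- **SINGLE-RATE FORM AT THE d = 3 CARRIER**: with `C₀ = 16e^{1/6} + 3·M_D(3,2)·C_per(κ₁₈₃(3),2)` and `δ₀ = min{1/6, κ₁₈₃(3)/3}`, under the hypotheses of
`abs_GE_le_decay_T3`: `|(Gx)(b)| ≤ C₀·B·e^{−δ₀t}`, `t = |ỹ − ỹ′|_{T,∞}` (both rates weakened to the smaller one, `t ≥ 0`).
[cite: Balaban1984PropagatorsI, Prop. 1.2 (1.110) p.35] -/
theorem abs_GE_le_exp_T3 (F : T3Family) (n K : ℕ)
    {w : BondIdx (twoScale (K - n) (succ_le_T3 F n K) (∅ : Finset (Site (F.P K) (K - n + 1)))) → ℝ}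
    (hw : ∀ i, 0 < w i) (hwa : ∀ p, w p = ((F.L : ℝ) ^ (K - n)) ^ 3)
    (x : BondSpace (F.P K)) {B : ℝ} (hxB : ∀ b', |x b'| ≤ B)
    (y y' : Site (F.P K) (K - n)) (hsupp : ∀ b', x b' ≠ 0 → b'.src ∈ iterBlock (K - n) y')
    (b : PBond (F.P K) 0) (hb : b.src ∈ iterBlock (K - n) y) :
    |GE (twoScale (K - n) (succ_le_T3 F n K) ∅) (c := ((F.L : ℝ)) ^ (K - n))
        (pow_ne_zero (K - n) (Nat.cast_ne_zero.2 (F.P K).L_pos.ne')) hw x b|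
      ≤ (16 * Real.exp (1 / 6) + 3 * (MD183 3 2 * periodConst (kappa183 3) 2)) * B *
          Real.exp (-(min (1 / 6) (kappa183 3 / 3) *
            torusSupNorm (Mk (F.P K) (K - n)) (rep (Mk (F.P K) (K - n)) y - rep (Mk (F.P K) (K - n)) y'))) := by
  have h := abs_GE_le_decay_T3 F n K hw hwa x hxB y y' hsupp b hb
  set t : ℝ := torusSupNorm (Mk (F.P K) (K - n)) (rep (Mk (F.P K) (K - n)) y - rep (Mk (F.P K) (K - n)) y') with ht
  have ht0 : 0 ≤ t := torusSupNorm_T3_nonneg F K (K - n) _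
  have hB : 0 ≤ B := (abs_nonneg _).trans (hxB b)
  have hC₁ : (0 : ℝ) ≤ 16 * Real.exp (1 / 6) := by positivity
  have hC₂ : (0 : ℝ) ≤ 3 * (MD183 3 2 * periodConst (kappa183 3) 2) :=
    mul_nonneg (by norm_num) (mul_nonneg (MD183_nonneg _ _) (periodConst_pos (kappa183_pos _) _).le)
  have he₁ : Real.exp (-(1 / 6 * t)) ≤ Real.exp (-(min (1 / 6) (kappa183 3 / 3) * t)) :=
    Real.exp_le_exp.2 (by nlinarith [min_le_left (1 / 6 : ℝ) (kappa183 3 / 3)])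
  have he₂ : Real.exp (-(kappa183 3 / 3 * t)) ≤ Real.exp (-(min (1 / 6) (kappa183 3 / 3) * t)) :=
    Real.exp_le_exp.2 (by nlinarith [min_le_right (1 / 6 : ℝ) (kappa183 3 / 3)])
  refine h.trans ?_
  have h1 : 16 * Real.exp (1 / 6) * Real.exp (-(1 / 6 * t)) ≤ 16 * Real.exp (1 / 6) * Real.exp (-(min (1 / 6) (kappa183 3 / 3) * t)) :=
    mul_le_mul_of_nonneg_left he₁ hC₁
  have h2 : 3 * (MD183 3 2 * periodConst (kappa183 3) 2 * Real.exp (-(kappa183 3 / 3 * t)))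
      ≤ 3 * (MD183 3 2 * periodConst (kappa183 3) 2) * Real.exp (-(min (1 / 6) (kappa183 3 / 3) * t)) := by
    have := mul_le_mul_of_nonneg_left he₂ hC₂
    linarith [this]
  calc B * (16 * Real.exp (1 / 6) * Real.exp (-(1 / 6 * t))
          + 3 * (MD183 3 2 * periodConst (kappa183 3) 2 * Real.exp (-(kappa183 3 / 3 * t))))
      ≤ B * (16 * Real.exp (1 / 6) * Real.exp (-(min (1 / 6) (kappa183 3 / 3) * t))
          + 3 * (MD183 3 2 * periodConst (kappa183 3) 2) * Real.exp (-(min (1 / 6) (kappa183 3 / 3) * t))) :=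
        mul_le_mul_of_nonneg_left (add_le_add h1 h2) hB
    _ = (16 * Real.exp (1 / 6) + 3 * (MD183 3 2 * periodConst (kappa183 3) 2)) * B *
          Real.exp (-(min (1 / 6) (kappa183 3 / 3) * t)) := by ring

/-- **PACKAGED FOR THE V2′/V3 CONSUMERS**: there are ABSOLUTE constants `C, δ > 0` such that for every member `F` of the T³ family, all heights `n, K`,
every weight function equal to `(L^{K−n})³` on the one-level structure at `j = K − n`, every real bond field `x` with `|x| ≤ B`:
(i) `|(Gx)(b)| ≤ C·B` at every bond; (ii) if `x` is supported on the bonds issuing from `B^{K−n}(y′)` then `|(Gx)(b)| ≤ C·B·e^{−δ|ỹ−ỹ′|_{T,∞}}` at every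
bond issuing from `B^{K−n}(y)` — [Balaban1984PropagatorsI] (1.115)/(1.110), first entries, for the flat one-level `G = Δ_1⁻¹` of [Balaban1984PropagatorsII]
(2.19)/(2.90) at the carrier. [cite: Balaban1984PropagatorsI, (1.110) p.35, (1.115) p.36; Balaban1984PropagatorsII, Prop. 2.2 (2.67) p.234] -/
theorem exists_flatG_sup_decay_T3 : ∃ C δ : ℝ, 0 < C ∧ 0 < δ ∧ ∀ (F : T3Family) (n K : ℕ)
    (w : BondIdx (twoScale (K - n) (succ_le_T3 F n K) (∅ : Finset (Site (F.P K) (K - n + 1)))) → ℝ)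
    (hw : ∀ i, 0 < w i), (∀ p, w p = ((F.L : ℝ) ^ (K - n)) ^ 3) →
    ∀ (x : BondSpace (F.P K)) (B : ℝ), (∀ b', |x b'| ≤ B) →
      (∀ b : PBond (F.P K) 0,
        |GE (twoScale (K - n) (succ_le_T3 F n K) ∅) (c := ((F.L : ℝ)) ^ (K - n))
          (pow_ne_zero (K - n) (Nat.cast_ne_zero.2 (F.P K).L_pos.ne')) hw x b| ≤ C * B) ∧
      (∀ (y y' : Site (F.P K) (K - n)), (∀ b', x b' ≠ 0 → b'.src ∈ iterBlock (K - n) y') →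
        ∀ b : PBond (F.P K) 0, b.src ∈ iterBlock (K - n) y →
          |GE (twoScale (K - n) (succ_le_T3 F n K) ∅) (c := ((F.L : ℝ)) ^ (K - n))
              (pow_ne_zero (K - n) (Nat.cast_ne_zero.2 (F.P K).L_pos.ne')) hw x b|
            ≤ C * B * Real.exp (-(δ * torusSupNorm (Mk (F.P K) (K - n)) (rep (Mk (F.P K) (K - n)) y - rep (Mk (F.P K) (K - n)) y')))) := by
  have hK₁ : 0 ≤ latticeConst 3 (1 / 6) := latticeConst_nonneg _ (by norm_num)
  have hK₂ : 0 ≤ latticeConst 3 (kappa183 3 / 3) := latticeConst_nonneg _ (div_pos (kappa183_pos _) (by norm_num)).le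
  have hM : 0 ≤ MD183 3 2 * periodConst (kappa183 3) 2 := mul_nonneg (MD183_nonneg _ _) (periodConst_pos (kappa183_pos _) _).le
  refine ⟨max (16 * Real.exp (1 / 6) * latticeConst 3 (1 / 6) + 3 * (MD183 3 2 * periodConst (kappa183 3) 2 * latticeConst 3 (kappa183 3 / 3)))
      (16 * Real.exp (1 / 6) + 3 * (MD183 3 2 * periodConst (kappa183 3) 2)),
    min (1 / 6) (kappa183 3 / 3), ?_, lt_min (by norm_num) (div_pos (kappa183_pos _) (by norm_num)), ?_⟩
  · exact lt_max_of_lt_right (by positivity)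
  intro F n K w hw hwa x B hxB
  have hB : ∀ b : PBond (F.P K) 0, 0 ≤ B := fun b => (abs_nonneg _).trans (hxB b)
  refine ⟨fun b => (abs_GE_le_sup_T3 F n K hw hwa x hxB b).trans ?_, fun y y' hsupp b hb => (abs_GE_le_exp_T3 F n K hw hwa x hxB y y' hsupp b hb).trans ?_⟩
  · rw [mul_comm]
    exact mul_le_mul_of_nonneg_right (le_max_left _ _) (hB b)
  · exact mul_le_mul_of_nonneg_right (mul_le_mul_of_nonneg_right (le_max_right _ _) (hB b)) (Real.exp_pos _).le

end T3

end Summit.QuantumFields.YangMills.Theorems.FlatPropagatorSup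

end
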